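import Summits.QuantumAdvantage.QuantumAdvantage.Theorems.HankelLiftBeyondRectanglesSampler
import Summits.QuantumAdvantage.QuantumAdvantage.Theorems.HankelLiftLiouvilleSumMemBQP
import Literature.Computability.Complexity.BPPErrorReduction
import Literature.Computability.Complexity.StackWords
import Literature.Computability.Cryptography.OneWayFunctions
import HarnessLib

/-!
# Route HankelLift, crux `BeyondRectangles` (stmt-QuantumAdvantage-18440): the registered stub
# `stub_antidiagonalSampling`, by name and signature

The registered skeleton `Cruxes/BeyondRectangles/Lines/birth.lean` (sha `f6a15a6c0aead5bb`) cuts the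
hypothesis-type crux `HankelLift.BeyondRectangles` into `stub_liouvilleBPPDark` (OPEN), `stub_antidiagonalSampling`
and `stub_successCalibration`.  This file proves the second one VERBATIM over the objects of
`HankelLiftBeyondRectanglesDefs.lean` (p555913), with the witness `B = sampler A` of
`HankelLiftBeyondRectanglesSampler.lean`:

  `stub_antidiagonalSampling : ∀ A PPT, ∃ B PPT, ∀ n, |pairCorr A n − sumCorr B n| ≤ 4ⁿ/30`.

Proof ("the sum-lift is transparent to PPT"):
* coins — conditioning on the `T`-bit prefix (`cnt_prefix`, `uniformProb_prefix`), a uniform `T`-bit block is a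
  uniform number `< 2^T` (`sum_vector_bitsToNat`), so `Pr[B(m) = true] = 2^{-T} Σ_{c<2^T} t(c mod R)` with
  `t(j) = Pr[A(lo + j, m − lo − j) = true]` (`sampler_pr`, `sampler_pr_eq_sum_range`);
* reduction mod `R` of a uniform `c < K` is `R/K`-close to uniform for `[0,1]`-valued tests
  (`abs_modSample_sub_avg_le`: `K = qR + s`, the deviation is `(R·S_s − s·S_R)/(KR)`, `|·| ≤ s/K`);
* hence on each antidiagonal `|rₙ(m)(2Pr_m − 1) − Σ_{x+y=m}(2t_A − 1)| ≤ 2rₙ(m)²/2^{n+7}`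
  (`antidiagonal_bound`), and regrouping `pairCorr` along antidiagonals (`pairCorr_fiberwise`, `λ(x+y+2)` is
  constant on each) with `rₙ(m) ≤ 2ⁿ`, `Σ_m rₙ(m) = 4ⁿ`, `|λ| ≤ 1` gives `|pairCorr − sumCorr| ≤ 4ⁿ/64 ≤ 4ⁿ/30`.

WHAT THIS IS NOT: not a proof of the crux — its load-bearing stub `LiouvilleBPPDark` is open (hypothesis-type);
with this file and `stub_successCalibration` the crux reduces to it (`HankelLiftBeyondRectangles.lean`).
-/

-- the sub-problem namespace `Summit.QuantumAdvantage.QuantumAdvantage` repeats the summit name by design (D-0017)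
set_option linter.dupNamespace false

noncomputable section

namespace Summit.QuantumAdvantage.QuantumAdvantage.Theorems.BeyondRectangles

open scoped BigOperators Classical
open Literature.Computability.Complexity
open _root_.Computability (encodeBool)

/-! ### Coins: conditioning on a prefix -/

/-- **Conditioning on the coin prefix**: `cnt (T + a) E = Σ_{u ∈ {0,1}^T} cnt a {v | u ++ v ∈ E}`. [folklore] -/
theorem cnt_prefix (T a : ℕ) : ∀ E : Set (List Bool),
    cnt (T + a) E = ∑ u : List.Vector Bool T, cnt a {v | u.toList ++ v ∈ E} := by
  induction T with
  | zero =>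
    intro E
    rw [Nat.zero_add]
    have huniv : (Finset.univ : Finset (List.Vector Bool 0)) = {List.Vector.nil} := by
      ext v; simp [List.Vector.eq_nil v]
    change cnt a E = ∑ u ∈ (Finset.univ : Finset (List.Vector Bool 0)), cnt a {v | u.toList ++ v ∈ E}
    rw [huniv, Finset.sum_singleton]
    simp
  | succ T ih =>
    intro E
    rw [show T + 1 + a = (T + a) + 1 by omega, cnt_succ, ih, ih]
    let e : Bool × List.Vector Bool T ≃ List.Vector Bool (T + 1) :=
      { toFun := fun p => p.1 ::ᵥ p.2
        invFun := fun v => (v.head, v.tail)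
        left_inv := fun p => by simp
        right_inv := fun v => List.Vector.cons_head_tail v }
    rw [← Fintype.sum_equiv e _ (fun v => cnt a {w | v.toList ++ w ∈ E}) (fun _ => rfl),
      Fintype.sum_prod_type, Fintype.sum_bool, add_comm]
    simp only [e, Equiv.coe_fn_mk, List.Vector.toList_cons, List.cons_append]
    rfl

/-- The same in probabilities: `Pr_{T+a}[E] = 2^{-T} Σ_u Pr_a[u ++ · ∈ E]`. [folklore] -/
theorem uniformProb_prefix (T a : ℕ) (E : Set (List Bool)) :
    uniformProb (T + a) E = (∑ u : List.Vector Bool T, uniformProb a {v | u.toList ++ v ∈ E}) / 2 ^ T := by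
  rw [uniformProb_eq_cnt_div, cnt_prefix, pow_add]
  simp only [uniformProb_eq_cnt_div]
  rw [← Finset.sum_div]
  push_cast
  rw [div_div, mul_comm]

/-! ### Coins: a block read as a number -/

/-- **A uniform `T`-bit block is a uniform number `< 2^T`.** [folklore] -/
theorem sum_vector_bitsToNat (T : ℕ) (g : ℕ → ℝ) :
    ∑ u : List.Vector Bool T, g (bitsToNat u.toList) = ∑ c ∈ Finset.range (2 ^ T), g c := by
  refine Finset.sum_nbij (fun u : List.Vector Bool T => bitsToNat u.toList) ?_ ?_ ?_ fun _ _ => rfl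
  · intro u _
    rw [Finset.mem_range]
    have := bitsToNat_lt u.toList
    rwa [u.toList_length] at this
  · intro u _ v _ h
    have huv := bitsToNat_injOn_length T (show u.toList ∈ {l : List Bool | l.length = T} from u.toList_length)
      (show v.toList ∈ {l : List Bool | l.length = T} from v.toList_length) h
    exact Subtype.ext huv
  · intro c hc
    rw [Finset.coe_range, Set.mem_Iio] at hc
    refine ⟨⟨List.ofFn fun i : Fin T => Nat.testBit c i, by simp⟩, Finset.mem_coe.2 (Finset.mem_univ _), ?_⟩
    exact HankelLift.bitsToNat_ofFn_testBit hc

/-! ### Near-uniform sampling by reduction modulo `R` -/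

/-- `Σ_{c < Rq} f(c mod R) = q · Σ_{j<R} f(j)`. [folklore] -/
theorem sum_range_mul_mod (f : ℕ → ℝ) (R : ℕ) : ∀ q : ℕ,
    ∑ c ∈ Finset.range (R * q), f (c % R) = (q : ℝ) * ∑ j ∈ Finset.range R, f j
  | 0 => by simp
  | q + 1 => by
    rw [Nat.mul_succ, Finset.sum_range_add, sum_range_mul_mod f R q]
    have h : ∀ i ∈ Finset.range R, f ((R * q + i) % R) = f i := fun i hi => by
      rw [Nat.mul_add_mod, Nat.mod_eq_of_lt (Finset.mem_range.1 hi)]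
    rw [Finset.sum_congr rfl h]
    push_cast
    ring

/-- Block decomposition of `Σ_{c<K} f(c mod R)`: `K / R` full periods and a remainder of length `K mod R`.
[folklore] -/
theorem sum_range_mod (f : ℕ → ℝ) {R : ℕ} (hR : 0 < R) (K : ℕ) :
    ∑ c ∈ Finset.range K, f (c % R) =
      ((K / R : ℕ) : ℝ) * ∑ j ∈ Finset.range R, f j + ∑ j ∈ Finset.range (K % R), f j := by
  conv_lhs => rw [← Nat.div_add_mod K R]
  rw [Finset.sum_range_add, sum_range_mul_mod]
  congr 1
  refine Finset.sum_congr rfl fun i hi => ?_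
  rw [Finset.mem_range] at hi
  rw [Nat.mul_add_mod, Nat.mod_eq_of_lt (lt_trans hi (Nat.mod_lt K hR))]

/-- **Sampling `j < R` as `c mod R` for a uniform `c < K` is `R/K`-close to uniform** (for a `[0,1]`-valued
test function): `|K⁻¹ Σ_{c<K} f(c mod R) − R⁻¹ Σ_{j<R} f(j)| ≤ R / K`. [folklore] -/
theorem abs_modSample_sub_avg_le (f : ℕ → ℝ) (hf0 : ∀ j, 0 ≤ f j) (hf1 : ∀ j, f j ≤ 1) {R K : ℕ}
    (hR : 0 < R) (hK : 0 < K) :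
    |(∑ c ∈ Finset.range K, f (c % R)) / K - (∑ j ∈ Finset.range R, f j) / R| ≤ (R : ℝ) / K := by
  set S := ∑ j ∈ Finset.range R, f j with hS
  set Ss := ∑ j ∈ Finset.range (K % R), f j with hSs
  set q : ℕ := K / R with hq
  set s : ℕ := K % R with hs
  have hKR : (K : ℝ) = R * q + s := by
    rw [hq, hs]; exact_mod_cast (Nat.div_add_mod K R).symm
  have hsR : (s : ℝ) ≤ R := by exact_mod_cast (Nat.mod_lt K hR).le
  have hS0 : 0 ≤ S := Finset.sum_nonneg fun j _ => hf0 j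
  have hS1 : S ≤ R := by
    have := Finset.sum_le_sum fun j (_ : j ∈ Finset.range R) => hf1 j
    simpa using this
  have hSs0 : 0 ≤ Ss := Finset.sum_nonneg fun j _ => hf0 j
  have hSs1 : Ss ≤ s := by
    have := Finset.sum_le_sum fun j (_ : j ∈ Finset.range (K % R)) => hf1 j
    simpa using this
  have hRpos : (0 : ℝ) < R := by exact_mod_cast hR
  have hKpos : (0 : ℝ) < K := by exact_mod_cast hK
  rw [sum_range_mod f hR K, ← hq, ← hSs]
  have key : ((q : ℝ) * S + Ss) / K - S / R = (R * Ss - s * S) / (K * R) := by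
    field_simp
    rw [hKR]
    ring
  rw [key, abs_div, abs_of_pos (mul_pos hKpos hRpos), div_le_div_iff₀ (mul_pos hKpos hRpos) hKpos]
  have h1 : |(R : ℝ) * Ss - s * S| ≤ R * s := by
    rw [abs_le]
    constructor <;> nlinarith
  calc |(R : ℝ) * Ss - s * S| * K ≤ R * s * K := by nlinarith
    _ = R * K * s := by ring
    _ ≤ R * K * R := mul_le_mul_of_nonneg_left hsR (by positivity)
    _ = R * (K * R) := by ring


/-! ### The acceptance probability of the sampler -/

/-- **`Pr[B(w) = true]` is the average over the coin block `u ∈ {0,1}^T` of `Pr[A(query(w,u)) = true]`.**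
[cite: AroraBarak2009, §7.1] -/
theorem sampler_pr (A : RandAlg (List Bool) Bool) (w : List Bool) :
    (sampler A).pr id w {true} =
      (∑ u : List.Vector Bool (sampT w), A.pr id (sampQuery w u.toList) {true}) / 2 ^ sampT w := by
  rw [RandAlg.pr_eq_uniformProb]
  have hcl : (sampler A).coinLen (id w).length = sampT w + A.coinLen (3 * (w.length - 1) + 2) := rfl
  rw [hcl, uniformProb_prefix]
  congr 1
  refine Finset.sum_congr rfl fun u _ => ?_
  rw [RandAlg.pr_eq_uniformProb,
    show (id (sampQuery w u.toList)).length = 3 * (w.length - 1) + 2 from length_sampQuery _ _]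
  congr 1
  ext v
  simp only [Set.mem_setOf_eq, sampler]
  rw [List.take_left' u.toList_length, List.drop_left' u.toList_length]

/-- The same with the block read as a number `c < 2^T`. [folklore] -/
theorem sampler_pr_eq_sum_range (A : RandAlg (List Bool) Bool) (w : List Bool) (g : ℕ → ℝ)
    (hg : ∀ u : List Bool, u.length = sampT w → A.pr id (sampQuery w u) {true} = g (bitsToNat u)) :
    (sampler A).pr id w {true} = (∑ c ∈ Finset.range (2 ^ sampT w), g c) / 2 ^ sampT w := by
  rw [sampler_pr, ← sum_vector_bitsToNat]
  congr 1
  exact Finset.sum_congr rfl fun u _ => hg u.toList u.toList_length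

/-! ### Per antidiagonal -/

/-- `|encSum n m| = n + 1`. [folklore] -/
theorem length_encSum (n m : ℕ) : (encSum n m).length = n + 1 := by simp [encSum]

/-- `val(encSum n m) = m` for `m < 2ⁿ⁺¹`. [folklore] -/
theorem bitsToNat_encSum {n m : ℕ} (hm : m < 2 ^ (n + 1)) : bitsToNat (encSum n m) = m :=
  HankelLift.bitsToNat_ofFn_testBit hm

/-- **One antidiagonal**: for `m < 2ⁿ⁺¹`,
`|rₙ(m)·(2·Pr[B(m)=true] − 1) − Σ_{x+y=m} (2·t_A(x,y) − 1)| ≤ 2·rₙ(m)²/2^{n+7}`. [folklore] -/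
theorem antidiagonal_bound (A : RandAlg (List Bool) Bool) {n m : ℕ} (hm : m < 2 ^ (n + 1)) :
    |(antidiag n m : ℝ) * (2 * (sampler A).pr id (encSum n m) {true} - 1) -
        ∑ p ∈ fiber n m, (2 * accept A n p - 1)| ≤
      2 * (antidiag n m : ℝ) ^ 2 / 2 ^ (n + 7) := by
  rw [antidiag_eq_adLen]
  rcases Nat.eq_zero_or_pos (adLen n m) with hR | hR
  · -- empty antidiagonal
    have hf : fiber n m = ∅ := by
      rw [← Finset.card_eq_zero, ← antidiag_eq_card_fiber, antidiag_eq_adLen, hR]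
    rw [hf, hR]
    simp
  · -- the test function along the antidiagonal
    set t : ℕ → ℝ := fun j => accept A n (adPt n m j) with ht
    have ht0 : ∀ j, 0 ≤ t j := fun j => RandAlg.pr_nonneg A _ _ _
    have ht1 : ∀ j, t j ≤ 1 := fun j => RandAlg.pr_le_one A _ _ _
    have hT : sampT (encSum n m) = n + 7 := by simp [sampT, length_encSum]
    -- B's acceptance probability on `m`
    have hPr : (sampler A).pr id (encSum n m) {true} =
        (∑ c ∈ Finset.range (2 ^ (n + 7)), t (c % adLen n m)) / 2 ^ (n + 7) := by
      rw [← hT]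
      refine sampler_pr_eq_sum_range A (encSum n m) (fun c => t (c % adLen n m)) fun u hu => ?_
      have hj : bitsToNat u % adLen n m < adLen n m := Nat.mod_lt _ hR
      obtain ⟨h1, h2⟩ := adPt_val hj
      simp only [ht, accept, sampQuery, sampX, length_encSum, Nat.add_sub_cancel, bitsToNat_encSum hm]
      rw [h1, h2]
    -- the antidiagonal sums
    have hS : ∑ p ∈ fiber n m, (2 * accept A n p - 1) = 2 * ∑ j ∈ Finset.range (adLen n m), t j - adLen n m := by
      rw [Finset.sum_sub_distrib, Finset.sum_const, ← antidiag_eq_card_fiber, antidiag_eq_adLen, nsmul_eq_mul,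
        mul_one, ← Finset.mul_sum, sum_fiber_eq]
    have hdev := abs_modSample_sub_avg_le (fun j => t j) ht0 ht1 hR (Nat.two_pow_pos (n + 7))
    rw [hPr, hS]
    have hRpos : (0 : ℝ) < adLen n m := by exact_mod_cast hR
    set P := (∑ c ∈ Finset.range (2 ^ (n + 7)), t (c % adLen n m)) / 2 ^ (n + 7) with hP
    set S := ∑ j ∈ Finset.range (adLen n m), t j with hSdef
    have hrew : (adLen n m : ℝ) * (2 * P - 1) - (2 * S - adLen n m) = 2 * adLen n m * (P - S / adLen n m) := by
      field_simp
      ring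
    rw [hrew, abs_mul, abs_of_pos (by positivity : (0 : ℝ) < 2 * adLen n m)]
    push_cast at hdev ⊢
    calc 2 * (adLen n m : ℝ) * |P - S / adLen n m| ≤ 2 * adLen n m * (adLen n m / 2 ^ (n + 7)) :=
        mul_le_mul_of_nonneg_left hdev (by positivity)
      _ = 2 * (adLen n m : ℝ) ^ 2 / 2 ^ (n + 7) := by ring

/-! ### Regrouping the pair correlation along antidiagonals -/

/-- **`pairCorr` along antidiagonals**: `pairCorr A n = Σ_{m<2ⁿ⁺¹} λ(m+2) · Σ_{x+y=m} (2·t_A(x,y) − 1)`. [folklore] -/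
theorem pairCorr_fiberwise (A : RandAlg (List Bool) Bool) (n : ℕ) :
    pairCorr A n = ∑ m ∈ Finset.range (2 ^ (n + 1)),
      ((ArithmeticFunction.liouville (m + 2) : ℤ) : ℝ) * ∑ p ∈ fiber n m, (2 * accept A n p - 1) := by
  unfold pairCorr
  rw [← Finset.sum_fiberwise_of_maps_to (s := (Finset.univ : Finset (Fin (2 ^ n) × Fin (2 ^ n))))
    (t := Finset.range (2 ^ (n + 1))) (g := fun p : Fin (2 ^ n) × Fin (2 ^ n) => p.1.val + p.2.val)
    (fun p _ => by rw [Finset.mem_range, pow_succ]; have := p.1.isLt; have := p.2.isLt; omega)]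
  refine Finset.sum_congr rfl fun m _ => ?_
  rw [Finset.mul_sum]
  refine Finset.sum_congr rfl fun p hp => ?_
  have hpm : p.1.val + p.2.val = m := (Finset.mem_filter.1 hp).2
  unfold hankelSign
  rw [hpm]

/-! ### Stub 2 -/

/-- **The sampler tracks the pair correlation**: `|pairCorr A n − sumCorr (sampler A) n| ≤ 4ⁿ/64 ≤ 4ⁿ/30`.
[cite: AroraBarak2009, §7.1] -/
theorem abs_pairCorr_sub_sumCorr_sampler_le (A : RandAlg (List Bool) Bool) (n : ℕ) :
    |pairCorr A n - sumCorr (sampler A) n| ≤ (4 : ℝ) ^ n / 30 := by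
  rw [abs_sub_comm, pairCorr_fiberwise]
  unfold sumCorr
  rw [← Finset.sum_sub_distrib]
  have hterm : ∀ m ∈ Finset.range (2 ^ (n + 1)),
      |(antidiag n m : ℝ) * ((ArithmeticFunction.liouville (m + 2) : ℤ) : ℝ) *
            (2 * (sampler A).pr id (encSum n m) {true} - 1) -
          ((ArithmeticFunction.liouville (m + 2) : ℤ) : ℝ) * ∑ p ∈ fiber n m, (2 * accept A n p - 1)| ≤
        (antidiag n m : ℝ) / 64 := by
    intro m hm
    rw [Finset.mem_range] at hm
    have hb := antidiagonal_bound A hm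
    -- `|λ(m+2)| ≤ 1` (`λ = (−1)^Ω`; as `MobiusLadder.abs_cast_liouville_le_one`, re-derived inline to avoid a
    -- second route cone)
    have hl : |((ArithmeticFunction.liouville (m + 2) : ℤ) : ℝ)| ≤ 1 := by
      rw [ArithmeticFunction.liouville_apply (show m + 2 ≠ 0 by omega)]
      rcases neg_one_pow_eq_or ℤ (ArithmeticFunction.cardFactors (m + 2)) with h | h <;> rw [h] <;> simp
    have hfac : (antidiag n m : ℝ) * ((ArithmeticFunction.liouville (m + 2) : ℤ) : ℝ) *
            (2 * (sampler A).pr id (encSum n m) {true} - 1) -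
          ((ArithmeticFunction.liouville (m + 2) : ℤ) : ℝ) * ∑ p ∈ fiber n m, (2 * accept A n p - 1) =
        ((ArithmeticFunction.liouville (m + 2) : ℤ) : ℝ) *
          ((antidiag n m : ℝ) * (2 * (sampler A).pr id (encSum n m) {true} - 1) -
            ∑ p ∈ fiber n m, (2 * accept A n p - 1)) := by ring
    rw [hfac, abs_mul]
    have hR : (antidiag n m : ℝ) ≤ 2 ^ n := by
      rw [antidiag_eq_adLen]; exact_mod_cast (adLen_le n m).trans (le_of_eq rfl)
    have hR0 : (0 : ℝ) ≤ antidiag n m := by positivity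
    calc |((ArithmeticFunction.liouville (m + 2) : ℤ) : ℝ)| *
          |(antidiag n m : ℝ) * (2 * (sampler A).pr id (encSum n m) {true} - 1) -
              ∑ p ∈ fiber n m, (2 * accept A n p - 1)|
        ≤ 1 * (2 * (antidiag n m : ℝ) ^ 2 / 2 ^ (n + 7)) :=
          mul_le_mul hl hb (abs_nonneg _) zero_le_one
      _ = (antidiag n m : ℝ) * (antidiag n m / 2 ^ n) / 64 := by rw [pow_add]; ring
      _ ≤ (antidiag n m : ℝ) * 1 / 64 := by
          gcongr
          rwa [div_le_one (by positivity)]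
      _ = (antidiag n m : ℝ) / 64 := by ring
  calc |∑ m ∈ Finset.range (2 ^ (n + 1)), _| ≤ ∑ m ∈ Finset.range (2 ^ (n + 1)), _ :=
      Finset.abs_sum_le_sum_abs _ _
    _ ≤ ∑ m ∈ Finset.range (2 ^ (n + 1)), (antidiag n m : ℝ) / 64 := Finset.sum_le_sum hterm
    _ = (4 : ℝ) ^ n / 64 := by rw [← Finset.sum_div, sum_antidiag]
    _ ≤ (4 : ℝ) ^ n / 30 := by
      apply div_le_div_of_nonneg_left (by positivity) (by norm_num) (by norm_num)

/-- **`stub_antidiagonalSampling` (registered name and signature)**: the sum-lift is transparent to PPT — for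
every PPT pair-predictor `A`, the PPT sum-predictor `sampler A` has `|pairCorr A n − sumCorr (sampler A) n| ≤ 4ⁿ/30`
at every level `n`. [cite: AroraBarak2009, §7.1] -/
theorem stub_antidiagonalSampling :
    ∀ A : RandAlg (List Bool) Bool, A.IsPolyTime id Computability.encodeBool →
      ∃ B : RandAlg (List Bool) Bool, B.IsPolyTime id Computability.encodeBool ∧
        ∀ n : ℕ, |pairCorr A n - sumCorr B n| ≤ (4 : ℝ) ^ n / 30 :=
  fun A hA => ⟨sampler A, sampler_isPolyTime hA, abs_pairCorr_sub_sumCorr_sampler_le A⟩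

end Summit.QuantumAdvantage.QuantumAdvantage.Theorems.BeyondRectangles

end
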